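import Summits.BirchSwinnertonDyer.BirchSwinnertonDyer.Theorems.ShaPrimaryTransferFiniteShaComponentTransferSelmerCubicKillSel
import Summits.BirchSwinnertonDyer.BirchSwinnertonDyer.Theorems.ShaPrimaryTransferFiniteShaComponentTransferSelmerCubicKillCertMod
import Summits.BirchSwinnertonDyer.BirchSwinnertonDyer.Theorems.Rank2Observatory2DescKillValid
import HarnessLib

/-!
# BirchSwinnertonDyer — SEL2CUBIC kill layer: the multi-kill sieve is sound on `2`-Selmer classes

HONEST FRAMING: route `ShaPrimaryTransfer`, seat `bsd-line-spt-p1` (g30), `--supports` item T =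
`FiniteShaComponentTransfer` (stmt-22356), UNCHANGED (conjecture-grade at corank ≥ 2). BSD in rank ≥ 2 is NOT
proved by any of this. THEOREMS ONLY.

* `not_isSquare_sel_of_killResidue_scaled` — `not_isSquare_sel_of_killResidue` for a curve root `e₀ ∈ 𝓞_K` read
  through a square scaling `r₁² · e₀ = t₀ + t₁α + t₂α²` (the two-view / split records write `X_t = m₁ · e`,
  `m₁ = r₁²`): the local Cassels data `a_w · (x(P) − e₀) ∈ K_w²` rescales to `z · ρ_w² = r₁² x(P) − θ'`.
* `admKills_sound_sel`, `admKillsV_sound_sel` — the Selmer-class forms of the landed `admKills_sound`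
  (`Rank2Observatory2DescKillList`, list certificate `killListCheck` with the residue trees `killCheck`) and
  `admKillsV_sound` (`Rank2Observatory2DescKillValid`, list certificate `killListCheckV` and a per-entry
  hypothesis): the sieve "admissible and none of the listed classes" accepts the Cassels class of every
  `2`-Selmer class, the per-entry hypothesis being the RESIDUE form «no `p`-primitive integer vector with
  `p^N ∣ Q₁, Q₂`» (supplied by `killCheck_sound_mod`, `sig3Check_sound_mod`, … of `…KillCertMod*`), which —
  unlike integer insolubility `KillValidAt` — is what a Selmer class contradicts.
[cite: Cassels1991LecturesEllipticCurves, §15] [cite: SilvermanAEC2009, Prop. X.1.4, X.§4] [cite: CremonaAlgorithms1997, §3.6]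
-/

-- single-conjunct summit: `Summit.BirchSwinnertonDyer.BirchSwinnertonDyer.…` repeats the name by design
set_option linter.dupNamespace false

noncomputable section

open scoped Classical NumberField

namespace Summit.BirchSwinnertonDyer.BirchSwinnertonDyer.Theorems.ShaPrimaryTransferSelmerCubicKill

open Summit.BirchSwinnertonDyer.BirchSwinnertonDyer.Rank2Observatory
open Summit.BirchSwinnertonDyer.BirchSwinnertonDyer.Rank2Observatory.TwoDescKill
open Summit.BirchSwinnertonDyer.BirchSwinnertonDyer.Rank2Observatory.TwoDescCubic
open Summit.BirchSwinnertonDyer.BirchSwinnertonDyer.Theorems.ShaPrimaryTransferSelmerCubicCover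
open Literature.NumberTheory.NumberFields Literature.NumberTheory.EllipticCurves
  Literature.NumberTheory.GaloisRepresentations IsDedekindDomain NumberField Module Polynomial
open WeierstrassCurve WeierstrassCurve.Affine

variable {K : Type} [Field K] [NumberField K] {a b c : ℤ} {α : K} {A B C : ℤ}

/-- **A `2`-Selmer class never meets a killed class (residue form), square-scaled root.** As
`not_isSquare_sel_of_killResidue`, for a root `e₀ ∈ 𝓞_K` of the curve cubic with `r₁² · e₀ = t₀ + t₁α + t₂α²`
(the kill quadrics are written at `(t₁, t₂)`): a residue certificate at `p` for `z ≠ 0` forbids `a_K · z ∈ K²`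
for the Cassels class `[a_K]` of any `c ∈ Sel⁽²⁾(E/ℚ)`. (Local Cassels uniformity at `v = p`, then
`z·ρ_w² = r₁²·x(P) − θ'` at every `w ∣ p`, then the local half `…KillLocal{,One}`.)
[cite: Cassels1991LecturesEllipticCurves, §15] [cite: SilvermanAEC2009, Prop. X.1.4, X.§4] [cite: CremonaAlgorithms1997, §3.6] -/
theorem not_isSquare_sel_of_killResidue_scaled (hirr : Irreducible (MonicCubic.polyQ a b c))
    (hα : aeval α (MonicCubic.poly a b c) = 0) (h3 : finrank ℚ K = 3)
    (E : WeierstrassCurve ℚ) [E.IsElliptic] (ha₁ : E.a₁ = 0) (ha₂ : E.a₂ = A) (ha₃ : E.a₃ = 0)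
    (ha₄ : E.a₄ = B) (ha₆ : E.a₆ = C) (e₀ : 𝓞 K)
    (hθ : aeval (algebraMap (𝓞 K) K e₀) (MonicCubic.poly A B C) = 0)
    [(E.baseChange K).IsElliptic] (t₀ t₁ t₂ : ℤ) (r₁ : ℕ)
    (he₀ : (r₁ : K) ^ 2 * algebraMap (𝓞 K) K e₀ = evZ α (t₀, t₁, t₂))
    {cS : galH1Torsion E 2} (hcS : cS ∈ selmerGroup E 2) (aK : Kˣ)
    (haK : kummerEquiv K 2 (E.oneRootDescentH1 K (isTwoTorsionX_of_aeval E ha₁ ha₂ ha₃ ha₄ ha₆ hθ) cS) =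
      Additive.ofMul (QuotientGroup.mk aK))
    {p : ℕ} (hp : p.Prime) {z₀ z₁ z₂ : ℤ} (hz : (z₀, z₁, z₂) ≠ ((0 : ℤ), (0 : ℤ), (0 : ℤ)))
    (hres : ∃ N : ℕ, ∀ v : ℤ × ℤ × ℤ × ℤ,
      ¬ ((p : ℤ) ∣ v.1 ∧ (p : ℤ) ∣ v.2.1 ∧ (p : ℤ) ∣ v.2.2.1 ∧ (p : ℤ) ∣ v.2.2.2) →
      (p : ℤ) ^ N ∣ (killQ a b c (z₀, z₁, z₂) t₁ t₂ v).1 → (p : ℤ) ^ N ∣ (killQ a b c (z₀, z₁, z₂) t₁ t₂ v).2 →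
      False) :
    ¬ IsSquare ((aK : K) * ((z₀ : K) + (z₁ : K) * α + (z₂ : K) * α ^ 2)) := by
  rintro ⟨tK, htK⟩
  obtain ⟨N, hN⟩ := hres
  haveI : Fact p.Prime := ⟨hp⟩
  -- `z ≠ 0` in `K`
  have hZ : ((z₀ : K) + (z₁ : K) * α + (z₂ : K) * α ^ 2) ≠ 0 := by
    intro h0
    have e : algebraMap ℚ K (z₂ : ℚ) * α ^ 2 + algebraMap ℚ K (z₁ : ℚ) * α + algebraMap ℚ K (z₀ : ℚ) = 0 := by
      simp only [map_intCast]; linear_combination h0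
    obtain ⟨f₀, f₁, f₂⟩ := powIndep_algebraMap hirr hα h3 _ _ _ e
    exact hz (Prod.ext (by exact_mod_cast f₀) (Prod.ext (by exact_mod_cast f₁) (by exact_mod_cast f₂)))
  have hZ' : evZ α (z₀, z₁, z₂) = (z₀ : K) + (z₁ : K) * α + (z₂ : K) * α ^ 2 := rfl
  -- the place `v = p` of `ℚ`
  set v : HeightOneSpectrum (𝓞 ℚ) := (Rat.HeightOneSpectrum.primesEquiv (R := 𝓞 ℚ)).symm ⟨p, hp⟩ with hv
  haveI : (E.baseChange (v.adicCompletion ℚ)).IsElliptic := E.isElliptic_baseChange _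
  -- a point `P ∈ E(ℚ_p)` carrying the class (local condition at `v`; `Place.Completion (inr v) = ℚ_v`)
  obtain ⟨P, hP'⟩ : ∃ P : (E.baseChange (v.adicCompletion ℚ)).toAffine.Point,
      resTorsion E (v.adicCompletion ℚ) 2 cS =
        kummerMapTorsion (E.baseChange (v.adicCompletion ℚ)) 2
          (E.two_zsmul_geomPoints_baseChange_surjective (v.adicCompletion ℚ)) P := by
    haveI : CharZero (NumberField.Place.Completion (K := ℚ) (Sum.inr v)) :=
      charZero_of_injective_algebraMap (algebraMap ℚ (v.adicCompletion ℚ)).injective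
    haveI : (E.baseChange (NumberField.Place.Completion (K := ℚ) (Sum.inr v))).IsElliptic :=
      E.isElliptic_baseChange _
    exact E.exists_resTorsion_eq_kummerMapTorsion_of_mem_selmerGroup hcS (Sum.inr v)
  have hθE := isTwoTorsionX_of_aeval E ha₁ ha₂ ha₃ ha₄ ha₆ hθ
  have ha' : kummerEquiv K 2 ((E.baseChange K).oneRootCharH1 hθE (resTorsion E K 2 cS)) =
      Additive.ofMul (QuotientGroup.mk aK) := by
    rw [← oneRootDescentH1_apply]; exact haK
  -- per-place data at every `w ∣ p`
  have key : ∀ w : v.Extension (𝓞 K),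
      (P = 0 → IsSquare (algebraMap K (w.1.adicCompletion K) (aK : K))) ∧
        ∀ {x y : v.adicCompletion ℚ} (hxy : (E.baseChange (v.adicCompletion ℚ)).toAffine.Nonsingular x y),
          P = Affine.Point.some x y hxy →
          IsSquare (algebraMap K (w.1.adicCompletion K) (aK : K) *
            (algebraMap (v.adicCompletion ℚ) (w.1.adicCompletion K) x -
              algebraMap K (w.1.adicCompletion K) (algebraMap (𝓞 K) K e₀))) := by
    intro w
    -- pin the `ℚ`-algebra structure of `ℚ_v` (a local instance beats `DivisionRing.toRatAlgebra`)
    letI instQv : Algebra ℚ (v.adicCompletion ℚ) := inferInstance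
    haveI : CharZero (v.adicCompletion ℚ) :=
      charZero_of_injective_algebraMap (algebraMap ℚ (v.adicCompletion ℚ)).injective
    haveI : CharZero (w.1.adicCompletion K) :=
      charZero_of_injective_algebraMap (algebraMap K (w.1.adicCompletion K)).injective
    haveI : (E.baseChange (w.1.adicCompletion K)).IsElliptic := E.isElliptic_baseChange _
    haveI : ((E.baseChange K).baseChange (w.1.adicCompletion K)).IsElliptic := (E.baseChange K).isElliptic_baseChange _
    haveI : ((E.baseChange (v.adicCompletion ℚ)).baseChange (w.1.adicCompletion K)).IsElliptic :=
      (E.baseChange (v.adicCompletion ℚ)).isElliptic_baseChange _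
    exact E.isSquare_of_resTorsion_eq (w.1.adicCompletion K) hθE cS aK ha' P hP'
  -- images in `K_w` of `a·z = t²`
  have hAZ : ∀ w : v.Extension (𝓞 K),
      algebraMap K (w.1.adicCompletion K) (aK : K) * algebraMap K (w.1.adicCompletion K) (evZ α (z₀, z₁, z₂)) =
        algebraMap K (w.1.adicCompletion K) tK * algebraMap K (w.1.adicCompletion K) tK := fun w => by
    rw [← map_mul, ← map_mul, hZ', htK]
  have hA0 : ∀ w : v.Extension (𝓞 K), algebraMap K (w.1.adicCompletion K) (aK : K) ≠ 0 := fun w => by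
    rw [map_ne_zero_iff _ (algebraMap K _).injective]; exact aK.ne_zero
  have hZ0 : ∀ w : v.Extension (𝓞 K), algebraMap K (w.1.adicCompletion K) (evZ α (z₀, z₁, z₂)) ≠ 0 := fun w => by
    rw [map_ne_zero_iff _ (algebraMap K _).injective, hZ']; exact hZ
  rcases P with _ | ⟨x, y, hxy⟩
  · -- locally trivial class: `z` is a square at every `w ∣ p`, the point of the covering at `n = 0`
    have hw : ∀ w : v.Extension (𝓞 K), ∃ ρw : w.1.adicCompletion K,
        algebraMap K (w.1.adicCompletion K) (evZ α (z₀, z₁, z₂)) * ρw ^ 2 = 1 := by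
      intro w
      obtain ⟨s, hs⟩ := (key w).1 rfl
      exact exists_mul_sq_eq_of_sq (hA0 w) (hZ0 w) (hAZ w) (by rw [mul_one]; exact hs)
    obtain ⟨u, hprim, h1, h2⟩ := exists_primitive_killQ_dvd_of_forall_extension_one hirr hα h3 (z₀, z₁, z₂) t₁ t₂ hw N
    exact hN u hprim h1 h2
  · -- affine point `(x, y) ∈ E(ℚ_p)`: `z·ρ_w² = r₁²·x − θ'` at every `w ∣ p`
    have hw : ∀ w : v.Extension (𝓞 K), ∃ ρw : w.1.adicCompletion K,
        algebraMap K (w.1.adicCompletion K) (evZ α (z₀, z₁, z₂)) * ρw ^ 2 =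
          algebraMap (v.adicCompletion ℚ) (w.1.adicCompletion K) ((r₁ : v.adicCompletion ℚ) ^ 2 * x) -
            algebraMap K (w.1.adicCompletion K) (evZ α (t₀, t₁, t₂)) := by
      intro w
      obtain ⟨s, hs⟩ := (key w).2 hxy rfl
      refine exists_mul_sq_eq_of_sq (hA0 w) (hZ0 w) (hAZ w) (s := (r₁ : w.1.adicCompletion K) * s) ?_
      rw [← he₀, map_mul, map_pow, map_natCast, map_mul, map_pow, map_natCast]
      linear_combination ((r₁ : w.1.adicCompletion K)) ^ 2 * hs
    obtain ⟨u, hprim, h1, h2⟩ :=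
      exists_primitive_killQ_dvd_of_forall_extension hirr hα h3 (z₀, z₁, z₂) t₀ t₁ t₂ _ hw N
    exact hN u hprim h1 h2

/-- **Soundness of the multi-kill sieve on Selmer classes** (list certificate `killListCheck`, residue trees
`killCheck` at the primes `2 … 23`): if `a_K · ∏_T u · ∏_U G ∈ K²` for the Cassels class `[a_K]` of a `2`-Selmer
class, `(T, U)` admissible, then `(T, U)` is none of the listed classes — a listed class has coordinates `z` with
a residue certificate, and `a_K · z ∈ K²` is excluded by `not_isSquare_sel_of_killResidue_scaled` (the residue
form of the tree, `killCheck_sound_mod`). The Selmer-class form of `admKills_sound`.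
[cite: Cassels1991LecturesEllipticCurves, §15] [cite: CremonaAlgorithms1997, §3.6] -/
theorem admKills_sound_sel (hirr : Irreducible (MonicCubic.polyQ a b c))
    (hα : aeval α (MonicCubic.poly a b c) = 0) (h3 : finrank ℚ K = 3)
    (E : WeierstrassCurve ℚ) [E.IsElliptic] (ha₁ : E.a₁ = 0) (ha₂ : E.a₂ = A) (ha₃ : E.a₃ = 0)
    (ha₄ : E.a₄ = B) (ha₆ : E.a₆ = C) (e₀ : 𝓞 K)
    (hθ : aeval (algebraMap (𝓞 K) K e₀) (MonicCubic.poly A B C) = 0)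
    [(E.baseChange K).IsElliptic] (t₀ : ℤ) {t₁ t₂ : ℤ} (r₁ : ℕ)
    (he₀ : (r₁ : K) ^ 2 * algebraMap (𝓞 K) K e₀ = evZ α (t₀, t₁, t₂))
    {m s : ℕ} (u : Fin m → 𝓞 K) (G : Fin s → 𝓞 K)
    {cu : Fin m → ℤ × ℤ × ℤ} {cg : Fin s → ℤ × ℤ × ℤ}
    (hu : ∀ i, u i = lin hα (cu i).1 (cu i).2.1 (cu i).2.2)
    (hG : ∀ j, G j = lin hα (cg j).1 (cg j).2.1 (cg j).2.2)
    {L : List (KillEntry m s)} (hL : killListCheck a b c t₁ t₂ cu cg L = true)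
    {adm : Finset (Fin m) → Finset (Fin s) → Bool} {T : Finset (Fin m)} {U : Finset (Fin s)}
    (hadm : adm T U = true)
    {cS : galH1Torsion E 2} (hcS : cS ∈ selmerGroup E 2) (aK : Kˣ)
    (haK : kummerEquiv K 2 (E.oneRootDescentH1 K (isTwoTorsionX_of_aeval E ha₁ ha₂ ha₃ ha₄ ha₆ hθ) cS) =
      Additive.ofMul (QuotientGroup.mk aK))
    (hsq : IsSquare ((aK : K) * (∏ i ∈ T, algebraMap (𝓞 K) K (u i)) * ∏ j ∈ U, algebraMap (𝓞 K) K (G j))) :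
    admKills adm L T U = true := by
  classical
  simp only [admKills, hadm, Bool.true_and, decide_eq_true_eq]
  rintro e he ⟨rfl, rfl⟩
  have hrel := MonicCubic.theta_rel hα
  have he' := List.all_eq_true.mp hL e he
  simp only [Bool.and_eq_true, decide_eq_true_eq] at he'
  obtain ⟨⟨⟨hp, hz⟩, hz0⟩, hk⟩ := he'
  rw [prod_eq_evZ hrel e.T cu _ (fun i => by rw [hu, algebraMap_lin_evZ]),
    prod_eq_evZ hrel e.U cg _ (fun j => by rw [hG, algebraMap_lin_evZ]), mul_assoc,
    ← evZ_mul3 hrel] at hsq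
  change IsSquare (_ * evZ α (prodCoords a b c cu cg e.T e.U)) at hsq
  rw [hz] at hsq
  obtain ⟨T', U', ⟨z₀, z₁, z₂⟩, p, fuel⟩ := e
  exact not_isSquare_sel_of_killResidue_scaled hirr hα h3 E ha₁ ha₂ ha₃ ha₄ ha₆ e₀ hθ t₀ t₁ t₂ r₁ he₀ hcS aK haK
    (prime_of_mem_killPrimes hp) hz0
    ⟨fuel + 1, fun v hprim h1 h2 => killCheck_sound_mod (prime_of_mem_killPrimes hp) hk v hprim ⟨h1, h2⟩⟩ hsq

/-- **Soundness of the multi-kill sieve on Selmer classes, validity form** (list certificate `killListCheckV`,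
any prime, any certificate shape): as `admKills_sound_sel`, the residue certificate of every entry («no
`p`-primitive integer vector `v` with `p^N ∣ Q₁(v), Q₂(v)`») being a hypothesis — discharged entry by entry by
`killCheck_sound_mod`, `sig3Check_sound_mod`, `sig2cCheck_sound_mod`, `sig8Check_sound_mod`,
`sig2xCheck_sound_mod`, `sig12uCheck_sound_mod`, `sig12rCheck_sound_mod`. The Selmer-class form of
`admKillsV_sound`. [cite: Cassels1991LecturesEllipticCurves, §15] [cite: CremonaAlgorithms1997, §3.6] -/
theorem admKillsV_sound_sel (hirr : Irreducible (MonicCubic.polyQ a b c))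
    (hα : aeval α (MonicCubic.poly a b c) = 0) (h3 : finrank ℚ K = 3)
    (E : WeierstrassCurve ℚ) [E.IsElliptic] (ha₁ : E.a₁ = 0) (ha₂ : E.a₂ = A) (ha₃ : E.a₃ = 0)
    (ha₄ : E.a₄ = B) (ha₆ : E.a₆ = C) (e₀ : 𝓞 K)
    (hθ : aeval (algebraMap (𝓞 K) K e₀) (MonicCubic.poly A B C) = 0)
    [(E.baseChange K).IsElliptic] (t₀ : ℤ) {t₁ t₂ : ℤ} (r₁ : ℕ)
    (he₀ : (r₁ : K) ^ 2 * algebraMap (𝓞 K) K e₀ = evZ α (t₀, t₁, t₂))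
    {m s : ℕ} (u : Fin m → 𝓞 K) (G : Fin s → 𝓞 K)
    {cu : Fin m → ℤ × ℤ × ℤ} {cg : Fin s → ℤ × ℤ × ℤ}
    (hu : ∀ i, u i = lin hα (cu i).1 (cu i).2.1 (cu i).2.2)
    (hG : ∀ j, G j = lin hα (cg j).1 (cg j).2.1 (cg j).2.2)
    {L : List (KillEntry m s)} (hL : killListCheckV a b c cu cg L = true)
    (hV : ∀ e ∈ L, ∃ N : ℕ, ∀ v : ℤ × ℤ × ℤ × ℤ,
      ¬ ((e.p : ℤ) ∣ v.1 ∧ (e.p : ℤ) ∣ v.2.1 ∧ (e.p : ℤ) ∣ v.2.2.1 ∧ (e.p : ℤ) ∣ v.2.2.2) →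
      (e.p : ℤ) ^ N ∣ (killQ a b c e.z t₁ t₂ v).1 → (e.p : ℤ) ^ N ∣ (killQ a b c e.z t₁ t₂ v).2 → False)
    {adm : Finset (Fin m) → Finset (Fin s) → Bool} {T : Finset (Fin m)} {U : Finset (Fin s)}
    (hadm : adm T U = true)
    {cS : galH1Torsion E 2} (hcS : cS ∈ selmerGroup E 2) (aK : Kˣ)
    (haK : kummerEquiv K 2 (E.oneRootDescentH1 K (isTwoTorsionX_of_aeval E ha₁ ha₂ ha₃ ha₄ ha₆ hθ) cS) =
      Additive.ofMul (QuotientGroup.mk aK))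
    (hsq : IsSquare ((aK : K) * (∏ i ∈ T, algebraMap (𝓞 K) K (u i)) * ∏ j ∈ U, algebraMap (𝓞 K) K (G j))) :
    admKills adm L T U = true := by
  classical
  simp only [admKills, hadm, Bool.true_and, decide_eq_true_eq]
  rintro e he ⟨rfl, rfl⟩
  have hrel := MonicCubic.theta_rel hα
  have he' := List.all_eq_true.mp hL e he
  simp only [Bool.and_eq_true, decide_eq_true_eq] at he'
  obtain ⟨⟨hp, hz⟩, hz0⟩ := he'
  have hk := hV e he
  rw [prod_eq_evZ hrel e.T cu _ (fun i => by rw [hu, algebraMap_lin_evZ]),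
    prod_eq_evZ hrel e.U cg _ (fun j => by rw [hG, algebraMap_lin_evZ]), mul_assoc,
    ← evZ_mul3 hrel] at hsq
  change IsSquare (_ * evZ α (prodCoords a b c cu cg e.T e.U)) at hsq
  rw [hz] at hsq
  obtain ⟨T', U', ⟨z₀, z₁, z₂⟩, p, fuel⟩ := e
  exact not_isSquare_sel_of_killResidue_scaled hirr hα h3 E ha₁ ha₂ ha₃ ha₄ ha₆ e₀ hθ t₀ t₁ t₂ r₁ he₀ hcS aK haK
    hp hz0 hk hsq

end Summit.BirchSwinnertonDyer.BirchSwinnertonDyer.Theorems.ShaPrimaryTransferSelmerCubicKill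

end
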